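import Literature.MathematicalPhysics.QuantumFieldTheory.Balaban1983to89.Node00.TorusCoverLandau153RecTowerMember
import Literature.MathematicalPhysics.QuantumFieldTheory.Balaban1983to89.Node00.TorusCoverLandau153RecCubeDomains

/-!
# NODE 00 — THE R7 DOOR AT THE PRINT DATUM OF A GRID CUBE (STAGES 1–3b in ONE theorem): from the RECORD crown body at the record datum `propCubePZ P k hk Mc ρ hρ idx` and the
# top-anchored lift `V x μ = ιSU (U ⟨π(x + c_k·𝟙), μ⟩)`, the torus gauge `u`, potential `A` and member witness `u_m` with EIGHT of N07's nine `HThm4Rec` rows in `HThm4Rec`'s own torus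
# currency (`π '' cube∕box (cornerP) (sideP) …`, `RE (domainsMeet (cubeDomains …) D₂) …`) plus the member rows the ninth (`Nrm`) row is made of

Cell `pub-ymgap`, width seat `pub-ymgap-dag-n07-w3` g10 (N05-REC R7 pen; LEAD PEN dag-n05-e).  NEW leaf, THEOREMS ONLY: ONE composition by name of this seat's FILE-7
(`exists_localGauge152_recTower_member`, STAGE 2 at the canonical windows) at `c := propCubePZ …` (STAGE 3a, whose projections `a ∕ M ∕ ρ ∕ k` are `cornerP ∕ sideP ∕ ρ ∕ k` by `rfl`) with
FILE-9 (`RE_dsE_re_im_eq_zero_meet_of_isLandau138Z_propCubePZ`, STAGE 3b) applied to its seventh row.  `--kind proof --supports stmt-QuantumFields-20541` (K0⁷; count-neutral).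
[15] = [Balaban1985Variational]; [6] = [Balaban1985RegularSpaces]; [B6] = [Balaban1984PropagatorsII]; [I] = [Balaban1987RG1].

WHAT IS PROVED (kernel; `P : Params`, `N ≥ 1`, `d ≥ 2`; no definition).  ★★★ `exists_datumGauge152_153_member_of_recBody`: for `1 ≤ k ≤ m + K`, `L ≤ ρ`, a grid index `idx`, a torus
field `U`, `0 ≤ r`, `4·(N r) < 2π`, the non-wrapping `InjOn π (tcube L (cornerP P Mc ρ idx) (sideP P Mc ρ) ρ k)` and the `SU(N)`-valued ∃-body of `GaugedBoundB8DZ L η_k V (propCubePZ …) r`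
(R6's conclusion at the record datum — the HYPOTHESIS): `∃ u A u_m` with (1) the gauge equation on `regionOfSet (π '' cube L (cornerP …) (sideP …) ρ k 0)` (⊇ `HThm4Rec`'s rows on `π '' box`
and `π '' cube … 0`); (2) the level letters `‖A ⟨π(x + c_k·𝟙), μ⟩‖ ≤ 2·(r·(Lʲη_k)⁻¹)` on the record cells' members `Ω′_j` (pointwise); (3)–(6) the four top letters on `π '' box L (cornerP …) (sideP …) k`
as `2rL ∕ 2rL² ∕ 2rL³ ∕ 2rL³`; (7) ★ [15] (153) at the meet with ANY second torus family `D₂`: `RE (domainsMeet (cubeDomains P (cornerP …) (sideP …) ρ k hck) D₂) η_k⁻¹ (dsE η_k⁻¹ (Re∕Im(φ∘A))) = 0`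
for every `φ` (`HThm4Rec`'s row at `D₂ := domainsOfSeq s.Ω k hck`); (8) the member rows — `A ⟨π(x + c_k·𝟙), μ⟩ = logCfg η_k (U″^{u_m⁻¹}) x μ` on `□̃ᶻ`, ★ `ιSU (u (π(x + c_k·𝟙))) = (u_m x)⁻¹·v_fix x`
on `□₀ᶻ`, `u_m ∈ SU(N)`, `u_m = 1` off `□₀ᶻ`, the RECORD's (1.29) `Restr129Z L k Λ′ 1 u_m`, the RECORD's (1.137) — the inputs of the `Nrm` row (this lineage's g9 FILES 40–42).
HONEST FRAMING: count-neutral composition by name over a HYPOTHESIS (R6's conclusion); the non-wrapping is DISPLAYED; nothing of [15] ∕ [6] ∕ [B6] ∕ [I] analysis asserted; `HThm4Rec`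
UNDISCHARGED (caveat (C-S3-1)) — this is NOT the knit: the `Nrm` row, the constants `κ := b9OfP …`, `a₀ := a0OfP …`, the `A_k` input from the run's bounds and R6 itself remain; N07 ∕ N05 NOT
discharged; counts unmoved; one finite 𝕋⁴ programme at fixed ε — R4 closes the conditional finite-𝕋⁴ rung `BalabanLadder.UV` only; the YM mass gap (Clay) is NOT proved by any of this;
nothing continuum ∕ ℝ⁴ ∕ OS.  No `sorry`, no `def`, no `instance`, no `notation`.

References: [15] (144)–(153) pp.300–301; [6] Prop. 6 (1.135)–(1.138) p.99, (1.29) p.81, (1.131) p.99, p.98; [B6] (2.7) p.224, (2.10)–(2.12) p.225; [3] = [Balaban1985Averaging] (78)–(81) p.30;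
[I] (0.1) p.251, (0.3)–(0.4) pp.252–253.
-/

noncomputable section

namespace Literature.MathematicalPhysics.QuantumFieldTheory.Balaban1983to89.Node00

open scoped Matrix.Norms.L2Operator
open B7Prop1Explicit (e e_apply gaugeAct)
open B7Prop1Local (InBox AgreeOn)
open B7Prop2Explicit (unitaryUnits mem_unitaryUnits)
open B7Prop2SpecialUnitary (specialUnitaryUnits mem_specialUnitaryUnits)
open BlockAveragingZd (avgIterZ ctrShift)
open B8Ineq132 (covDerivFwd covDeriv BondTouches)
open B8Eq131Cubes (box cube tcube tLo tHi ctr gs)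
open B8Eq131CubesRec (boxZ cubeZ tcubeZ bLoZ bHiZ)
open B8Eq140Level (SideTouches)
open B8Eq138LandauZd (logCfg covDivB covLap)
open B8Eq138LandauZdRec (IsLandau138Z IsLandau138WZ)
open B8Eq119TwistedAxialRec (Restr129Z)
open B7SectEFLinearisationRec (logCovIterZ)
open B8Eq184Proof (cfgExp)
open B8LeafModelZd3 (mlogCfg)
open B8ScaledSupNorm (msup Bdd bondNorm)
open B8Eq146AExpansion (plaqCovDeriv iEta)
open B8Eq143PlaqExpansion (pdiv)
open MatrixLog (mlog)
open B15Eq112TorusCover (cover)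
open B14DomainGeom (Pt)
open B12RegularSpaces111 (gaugeU expI grad)
open B6SectADomainsV1 (Domains)
open B6SectAOperatorsV1 (RE dsE QpE)
open BalabanImbrieJaffe1984to88.BIJ85AxialPropagator411 (BondSpace)

variable {P : Params} {N : ℕ} [NeZero N]

/-- ★★★ **THE R7 DOOR AT THE PRINT DATUM** (statement in the module docstring).
[cite: Balaban1985Variational, (144)–(153) pp.300–301; Balaban1985RegularSpaces, Prop. 6 (1.135)–(1.138) p.99, (1.29) p.81, (1.131) p.99; Balaban1984PropagatorsII, (2.10)–(2.12) p.225; Balaban1985Averaging, (78)–(81) p.30; Balaban1987RG1, (0.1) p.251, (0.3)–(0.4) pp.252–253] -/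
theorem exists_datumGauge152_153_member_of_recBody (hd : 2 ≤ P.d) {k : ℕ} (hk₁ : 1 ≤ k) (hck : k ≤ P.m + P.K) {Mc ρ : ℕ} (hρ : P.L ≤ ρ) (idx : Pt P.d)
    (U : GaugeField P 0 (SU N)) {r : ℝ} (hr : 0 ≤ r)
    (hG : letI : CStarAlgebra (MatA N) := {};
      ∃ u : B7Prop1Explicit.Site P.d → (MatA N)ˣ, (∀ x, u x ∈ specialUnitaryUnits (Fin N)) ∧ (∀ x, x ∉ (propCubePZ P k hk₁ Mc ρ hρ idx).sq 0 → u x = 1) ∧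
        Restr129Z P.L k (propCubePZ P k hk₁ Mc ρ hρ idx).lamS (1 : B7Prop1Explicit.Site P.d → Fin P.d → (MatA N)ˣ) u ∧
        IsLandau138WZ P.L k (P.eta k) ((propCubePZ P k hk₁ Mc ρ hρ idx).sq 0) (propCubePZ P k hk₁ Mc ρ hρ idx).lamS (1 : B7Prop1Explicit.Site P.d → Fin P.d → (MatA N)ˣ)
          ((propCubePZ P k hk₁ Mc ρ hρ idx).fixed (fun x μ => ιSU N (U ⟨cover P (x + fun _ => (ctrShift P.L k : ℤ)), μ⟩)) u) ∧
        (∀ j, j ≤ k → ∀ b ∈ {b : B7Prop1Explicit.Site P.d × Fin P.d | SideTouches ((propCubePZ P k hk₁ Mc ρ hρ idx).sq j) b.1 b.2},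
          (propCubePZ P k hk₁ Mc ρ hρ idx).fixed (fun x μ => ιSU N (U ⟨cover P (x + fun _ => (ctrShift P.L k : ℤ)), μ⟩)) u b.1 b.2 =
              cfgExp (P.eta k) (logCfg (P.eta k) ((propCubePZ P k hk₁ Mc ρ hρ idx).fixed (fun x μ => ιSU N (U ⟨cover P (x + fun _ => (ctrShift P.L k : ℤ)), μ⟩)) u)) b.1 b.2 ∧
            IsSelfAdjoint (logCfg (P.eta k) ((propCubePZ P k hk₁ Mc ρ hρ idx).fixed (fun x μ => ιSU N (U ⟨cover P (x + fun _ => (ctrShift P.L k : ℤ)), μ⟩)) u) b.1 b.2) ∧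
            ‖logCfg (P.eta k) ((propCubePZ P k hk₁ Mc ρ hρ idx).fixed (fun x μ => ιSU N (U ⟨cover P (x + fun _ => (ctrShift P.L k : ℤ)), μ⟩)) u) b.1 b.2‖ ≤
              r * ((P.L : ℝ) ^ j * P.eta k)⁻¹) ∧
        (∀ x, (((propCubePZ P k hk₁ Mc ρ hρ idx).vfix (fun x μ => ιSU N (U ⟨cover P (x + fun _ => (ctrShift P.L k : ℤ)), μ⟩)))⁻¹ * u) x ∈ specialUnitaryUnits (Fin N)) ∧
        AgreeOn (B8Ineq130Rec.tlo P.L (tLo (cornerP P Mc ρ idx) ρ) k) (B8Ineq130Rec.thi P.L (tHi (cornerP P Mc ρ idx) (sideP P Mc ρ) ρ) k)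
          (gaugeAct (((propCubePZ P k hk₁ Mc ρ hρ idx).vfix (fun x μ => ιSU N (U ⟨cover P (x + fun _ => (ctrShift P.L k : ℤ)), μ⟩)))⁻¹ * u)⁻¹
            (fun x μ => ιSU N (U ⟨cover P (x + fun _ => (ctrShift P.L k : ℤ)), μ⟩)))
          ((propCubePZ P k hk₁ Mc ρ hρ idx).fixed (fun x μ => ιSU N (U ⟨cover P (x + fun _ => (ctrShift P.L k : ℤ)), μ⟩)) u) ∧
        msup P.L k (P.eta k) (-(2 : ℝ)) (fun j (q : Fin P.d × Fin P.d × B7Prop1Explicit.Site P.d) => SideTouches ((propCubePZ P k hk₁ Mc ρ hρ idx).sq j) q.2.2 q.2.1)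
            (fun q => covDerivFwd (P.eta k) (1 : B7Prop1Explicit.Site P.d → Fin P.d → (MatA N)ˣ) q.1
              (fun z => (propCubePZ P k hk₁ Mc ρ hρ idx).expo (P.eta k) (fun x μ => ιSU N (U ⟨cover P (x + fun _ => (ctrShift P.L k : ℤ)), μ⟩)) u z q.2.1) q.2.2) ≤ r ∧
        bondNorm P.L k (P.eta k) (-(3 : ℝ)) (propCubePZ P k hk₁ Mc ρ hρ idx).sq
            (fun x μ => pdiv (P.eta k) (1 : B7Prop1Explicit.Site P.d → Fin P.d → (MatA N)ˣ)
              (plaqCovDeriv (P.eta k) (1 : B7Prop1Explicit.Site P.d → Fin P.d → (MatA N)ˣ)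
                ((propCubePZ P k hk₁ Mc ρ hρ idx).expo (P.eta k) (fun x μ => ιSU N (U ⟨cover P (x + fun _ => (ctrShift P.L k : ℤ)), μ⟩)) u)) μ x) ≤ r ∧
        bondNorm P.L k (P.eta k) (-(3 : ℝ)) (propCubePZ P k hk₁ Mc ρ hρ idx).sq
            (fun x μ => covLap (P.eta k) (1 : B7Prop1Explicit.Site P.d → Fin P.d → (MatA N)ˣ)
              (fun z => (propCubePZ P k hk₁ Mc ρ hρ idx).expo (P.eta k) (fun x μ => ιSU N (U ⟨cover P (x + fun _ => (ctrShift P.L k : ℤ)), μ⟩)) u z μ) x) ≤ r ∧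
        (∀ (x : B7Prop1Explicit.Site P.d) (μ : Fin P.d), bLoZ P.L (cornerP P Mc ρ idx) 0 0 ≤ x → x + e μ ≤ bHiZ P.L (cornerP P Mc ρ idx) (sideP P Mc ρ) 0 0 →
          (propCubePZ P k hk₁ Mc ρ hρ idx).inTop x → (propCubePZ P k hk₁ Mc ρ hρ idx).inTop (x + e μ) →
          logCovIterZ P.L (1 : B7Prop1Explicit.Site P.d → Fin P.d → (MatA N)ˣ)
              (iEta (P.eta k) ((propCubePZ P k hk₁ Mc ρ hρ idx).expo (P.eta k) (fun x μ => ιSU N (U ⟨cover P (x + fun _ => (ctrShift P.L k : ℤ)), μ⟩)) u)) k x μ =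
            mlog ((avgIterZ P.L ((propCubePZ P k hk₁ Mc ρ hρ idx).axial (fun x μ => ιSU N (U ⟨cover P (x + fun _ => (ctrShift P.L k : ℤ)), μ⟩))) k x μ : (MatA N)ˣ) :
              MatA N)))
    (hinj : Set.InjOn (cover P) (tcube P.L (cornerP P Mc ρ idx) (sideP P Mc ρ) ρ k)) (h4 : 4 * ((N : ℝ) * r) < 2 * Real.pi) :
    letI : CStarAlgebra (MatA N) := {}
    ∃ u : GaugeTransf P 0 (SU N), ∃ A : PBond P 0 → MatA N, ∃ um : B7Prop1Explicit.Site P.d → (MatA N)ˣ,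
      (∀ b ∈ (Sect2.regionOfSet P (cover P '' cube P.L (cornerP P Mc ρ idx) (sideP P Mc ρ) ρ k 0)).bonds,
          gaugeU (fun x => ιSU N (u x)) (fun b' => ιSU N (U b')) b = expI (P.eta k) (A b)) ∧
      (∀ j, j ≤ k → ∀ (x : Pt P.d) (μ : Fin P.d), x ∈ (propCubePZ P k hk₁ Mc ρ hρ idx).sq j → x + e μ ∈ (propCubePZ P k hk₁ Mc ρ hρ idx).sq j →
          ‖A ⟨cover P (x + fun _ => (ctrShift P.L k : ℤ)), μ⟩‖ ≤ 2 * (r * ((P.L : ℝ) ^ j * P.eta k)⁻¹)) ∧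
      (∀ b ∈ (Sect2.regionOfSet P (cover P '' box P.L (cornerP P Mc ρ idx) (sideP P Mc ρ) k)).bonds, ‖A b‖ ≤ 2 * (r * P.L)) ∧
      (∀ q ∈ (Sect2.regionOfSet P (cover P '' box P.L (cornerP P Mc ρ idx) (sideP P Mc ρ) k)).dpairs,
          ‖grad (P.eta k) q.2.1 (fun y => A ⟨y, q.2.2⟩) q.1‖ ≤ 2 * (r * (P.L : ℝ) ^ 2)) ∧
      (∀ b ∈ Sect2.bondsDeep (cover P '' box P.L (cornerP P Mc ρ idx) (sideP P Mc ρ) k), ‖Sect2.codiffCurlA (P.eta k) A b.src b.dir‖ ≤ 2 * (r * (P.L : ℝ) ^ 3)) ∧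
      (∀ b ∈ Sect2.bondsDeep (cover P '' box P.L (cornerP P Mc ρ idx) (sideP P Mc ρ) k),
          ‖∑ ν : Fin P.d, ((P.eta k : ℝ) : ℂ)⁻¹ •
              (grad (P.eta k) ν (fun y => A ⟨y, b.dir⟩) (b.src.unshift ν) - grad (P.eta k) ν (fun y => A ⟨y, b.dir⟩) b.src)‖ ≤ 2 * (r * (P.L : ℝ) ^ 3)) ∧
      (∀ (D₂ : Domains P) (φ : MatA N →L[ℂ] ℂ),
        RE (domainsMeet (cubeDomains P (cornerP P Mc ρ idx) (sideP P Mc ρ) ρ k hck) D₂) (P.eta k)⁻¹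
            (dsE (P.eta k)⁻¹ (WithLp.toLp 2 fun b => (φ (A b)).re : BondSpace P)) = 0 ∧
          RE (domainsMeet (cubeDomains P (cornerP P Mc ρ idx) (sideP P Mc ρ) ρ k hck) D₂) (P.eta k)⁻¹
            (dsE (P.eta k)⁻¹ (WithLp.toLp 2 fun b => (φ (A b)).im : BondSpace P)) = 0) ∧
      (∀ x, x ∈ tcubeZ P.L (cornerP P Mc ρ idx) (sideP P Mc ρ) ρ k → ∀ μ,
          A ⟨cover P (x + fun _ => (ctrShift P.L k : ℤ)), μ⟩ =
            logCfg (P.eta k) ((propCubePZ P k hk₁ Mc ρ hρ idx).fixed (fun x μ => ιSU N (U ⟨cover P (x + fun _ => (ctrShift P.L k : ℤ)), μ⟩)) um) x μ) ∧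
      (∀ x, x ∈ (propCubePZ P k hk₁ Mc ρ hρ idx).sq 0 →
          ιSU N (u (cover P (x + fun _ => (ctrShift P.L k : ℤ)))) =
            (um x)⁻¹ * (propCubePZ P k hk₁ Mc ρ hρ idx).vfix (fun x μ => ιSU N (U ⟨cover P (x + fun _ => (ctrShift P.L k : ℤ)), μ⟩)) x) ∧
      (∀ x, um x ∈ specialUnitaryUnits (Fin N)) ∧ (∀ x, x ∉ (propCubePZ P k hk₁ Mc ρ hρ idx).sq 0 → um x = 1) ∧
      Restr129Z P.L k (propCubePZ P k hk₁ Mc ρ hρ idx).lamS (1 : B7Prop1Explicit.Site P.d → Fin P.d → (MatA N)ˣ) um ∧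
      (∀ (x : B7Prop1Explicit.Site P.d) (μ : Fin P.d), bLoZ P.L (cornerP P Mc ρ idx) 0 0 ≤ x → x + e μ ≤ bHiZ P.L (cornerP P Mc ρ idx) (sideP P Mc ρ) 0 0 →
        (propCubePZ P k hk₁ Mc ρ hρ idx).inTop x → (propCubePZ P k hk₁ Mc ρ hρ idx).inTop (x + e μ) →
        logCovIterZ P.L (1 : B7Prop1Explicit.Site P.d → Fin P.d → (MatA N)ˣ)
            (iEta (P.eta k) ((propCubePZ P k hk₁ Mc ρ hρ idx).expo (P.eta k) (fun x μ => ιSU N (U ⟨cover P (x + fun _ => (ctrShift P.L k : ℤ)), μ⟩)) um)) k x μ =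
          mlog ((avgIterZ P.L ((propCubePZ P k hk₁ Mc ρ hρ idx).axial (fun x μ => ιSU N (U ⟨cover P (x + fun _ => (ctrShift P.L k : ℤ)), μ⟩))) k x μ : (MatA N)ˣ) :
            MatA N)) := by
  letI : CStarAlgebra (MatA N) := {}
  set c := propCubePZ P k hk₁ Mc ρ hρ idx with hc
  obtain ⟨u, A, um, h1, hlev, h2, h3, h4c, h4', hA7, h5, hsid, hsu, hoff, h129, h137⟩ :=
    exists_localGauge152_recTower_member (P := P) (N := N) hd c U (n := k) rfl hr hG hinj h4
  have hinj0 : Set.InjOn (cover P) (cube P.L (cornerP P Mc ρ idx) (sideP P Mc ρ) ρ k 0) :=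
    hinj.mono (B8Eq131Cubes.cube_subset_tcube P.hL.2 (le_trans (le_trans (by norm_num) P.hL.2) hρ) (Nat.zero_le _))
  have hA0 : ∀ x, x ∈ c.sq 0 → ∀ κ, A ⟨cover P (x + fun _ => (ctrShift P.L k : ℤ)), κ⟩ =
      logCfg (P.eta k) (c.fixed (fun x μ => ιSU N (U ⟨cover P (x + fun _ => (ctrShift P.L k : ℤ)), μ⟩)) um) x κ :=
    fun x hx κ => hA7 x (CubeB8DZ.sq_zero_subset_tcube P.hL.1 P.hL.2 c hx) κ
  exact ⟨u, A, um, h1, hlev, h2, h3, h4c, h4', fun D₂ φ => RE_dsE_re_im_eq_zero_meet_of_isLandau138Z_propCubePZ hk₁ hρ idx hck hinj0 hA0 h5 D₂ φ,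
    hA7, hsid, hsu, hoff, h129, h137⟩

end Literature.MathematicalPhysics.QuantumFieldTheory.Balaban1983to89.Node00

end

/-! ## Axiom audit (gate whitelist: `propext`, `Classical.choice`, `Quot.sound`) -/
#print axioms Literature.MathematicalPhysics.QuantumFieldTheory.Balaban1983to89.Node00.exists_datumGauge152_153_member_of_recBody
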